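import Summits.QuantumFields.BalabanUV.Beta.FP.TorusCombRows

/-!
# `BalabanUV.Beta.FP.TorusCombSlots` — road «FP» for binder row D1, ROUTE T, RULING R-FP-52 (2): THE COMB FIELD SLOTS OF THE TORUS BOX ARE IN BIJECTION WITH THE
# RESIDUAL GAUGE PARAMETERS — `Res ρ N M ≃ CombSlot ρ N M` through «comb bond INTO x ↦ x» (`combBondT`) and «comb bond ↦ its endpoint farther from the root»
# (`childOf`); hence the comb-coordinate slice rows `combRowsT` are supported EXACTLY on an2's dead field coordinates (where `axEc` vanishes on the field block)
# — the `t ≃ Res` sorting the `kkt`∕`kBig` dress of `RelInvCompression` §3 ∕ `RelInvPeriodised` asks for (leaf-05 W-d1leaf05g23-3 (2))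

HONEST DEPENDENCY (page 1, mandatory): continuum YM on T⁴ ⇐ BetaPertH ∧ nine spine estimates (0/9 proved); BetaPertH ⇐ (D1) ∧ (D4) ∧ CAP+tail;
G-an2-4 gates asym, D1 and NE2/3/4.  HONEST FRAMING (cell contract, verbatim): «discharging `BetaPertH` makes Bałaban's UV stability UNCONDITIONAL —
a real constructive-QFT result; it is NOT the continuum limit and NOT the Clay problem.»  ABSOLUTE RULE (cell charter, verbatim): «No internally-minted
statement may enter as a cited fact. Every hypothesis is either kernel-proved in this package or a verbatim quotation of a PUBLISHED theorem with page
reference. The manuscript(s) under audit are NOT citable for their own disputed steps — they are the thing under adjudication; programme-internal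
(2001/route/tribunal) claims are never citable.»  THIS MODULE is [our object — bookkeeping] + [folklore] lattice combinatorics over `FP/TorusCombForest` ∕ `FP/TorusCombRows`
and an2's `AxialDressingRooted.IsCombBondAt`; no `def … : Prop`, nothing cited, 0 sorry.  «not in print; our bookkeeping».

CONTENT (every `d`; `0 < N`, `0 ≤ ρ_i < N`, `N ∣ M_i`).
* §1 more forest letters: `axisOf_eq_of` (a coordinate that deviates while all lower ones sit at the root IS the axis), `rootOf_add_unitVec_of_isCombBondAt` (both endpoints of a
  comb bond have the same root), `add_unitVec_mem_pbox_of_isCombBondAt` (and lie in the box).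
* §2 [our object — bookkeeping] **`CombSlot ρ N M`** := the field slots `(p, inl m)` of `Idx M (Fib d)` with `IsCombBondAt ρ N m p` (a subtype; `Fintype`, `DecidableEq`);
  **`childOf`** (the endpoint of a comb bond farther from the root, as a residual parameter); `combSlotOf` (`combBondT` with its comb certificate `isCombBondAt_baseOf`).
* §3 **`resEquivCombSlot : Res ρ N M ≃ CombSlot ρ N M`** (`childOf_combSlotOf`, `combSlotOf_childOf`); corollaries `combBondT_injective`, `card_res_eq_card_combSlot`, and
  **`combRowsT_apply_eq_zero_of_not_comb`** (the slice rows vanish off the comb field slots — i.e. on an2's LIVE coordinates).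
0 estimates; 0∕4 row-D1 binders; NOT the dress itself, NOT (T-ID) complete, NOT SDF, NOT D1, NOT BetaPertH, NOT continuum, NOT Clay.
Provenance: D1 formalisation swarm LEAF PROVER 06, unit b2b-balaban-beta-d1-formalise-leaf-06 gen 16, 2026-08-21.  No existing file touched.
-/

noncomputable section

namespace Summit.QuantumFields.BalabanUV.Beta.FP.TorusCombSlots

open Finset Matrix
open Literature.MathematicalPhysics.QuantumFieldTheory.Balaban1983to89
open Literature.MathematicalPhysics.QuantumFieldTheory.Balaban1983to89.Beta
open AffineAveraging (Site unitVec unitVec_apply)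
open AveragingContours (blk)
open B6Lemma24Torus (pbox mem_pbox)
open OneStepResolventKernel (Fib)
open Summit.QuantumFields.BalabanUV.Beta.AxialDressingRooted (IsCombBondAt)
open Summit.QuantumFields.BalabanUV.Beta.FP.KernelPeriodisationFib (Idx)
open Summit.QuantumFields.BalabanUV.Beta.FP.TorusCombForest
open Summit.QuantumFields.BalabanUV.Beta.FP.TorusCombRows

variable {d : ℕ}

/-! ## §1 More forest letters -/

section Forest

variable {ρ : Site (d + 1)} {N : ℕ}

/-- [folklore] **RECOGNISING THE AXIS**: if `x` deviates from its root on coordinate `m` and sits at the root on every lower coordinate, then `axisOf x = m`. -/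
theorem axisOf_eq_of {x : Site (d + 1)} {m : Fin (d + 1)} (hm : x m ≠ rootOf ρ N x m) (hlow : ∀ j, j < m → x j = rootOf ρ N x j) :
    axisOf ρ N x = m := by
  have hmem : m ∈ devSet ρ N x := Finset.mem_filter.2 ⟨Finset.mem_univ _, hm⟩
  have hne : (devSet ρ N x).Nonempty := ⟨m, hmem⟩
  rw [axisOf, dif_pos hne]
  apply le_antisymm (Finset.min'_le _ _ hmem)
  by_contra h
  have hlt : (devSet ρ N x).min' hne < m := not_le.1 h
  have hmin := Finset.min'_mem (devSet ρ N x) hne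
  exact (Finset.mem_filter.1 hmin).2 (hlow _ hlt)

/-- [folklore] the coordinates of `p + e_m`. -/
theorem add_unitVec_apply (p : Site (d + 1)) (m j : Fin (d + 1)) : (p + unitVec m) j = if j = m then p m + 1 else p j := by
  rw [Pi.add_apply, unitVec_apply]
  by_cases h : j = m
  · subst h; rw [if_pos rfl, if_pos rfl]
  · rw [if_neg h, if_neg h, add_zero]

/-- [folklore] **BOTH ENDPOINTS OF A COMB BOND HAVE THE SAME BLOCK QUOTIENTS** (the `blk` clause of `IsCombBondAt`). -/
theorem ediv_add_unitVec_of_isCombBondAt {m : Fin (d + 1)} {p : Site (d + 1)} (h : IsCombBondAt ρ N m p) (j : Fin (d + 1)) :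
    (p + unitVec m) j / (N : ℤ) = p j / (N : ℤ) := by
  have hb := congrFun h.2 j
  simpa only [blk] using hb

/-- [folklore] … hence the same root. -/
theorem rootOf_add_unitVec_of_isCombBondAt {m : Fin (d + 1)} {p : Site (d + 1)} (h : IsCombBondAt ρ N m p) :
    rootOf ρ N (p + unitVec m) = rootOf ρ N p :=
  rootOf_congr (ediv_add_unitVec_of_isCombBondAt h)

/-- [folklore] **THE TIP OF A COMB BOND LIES IN THE BOX** when its base does and the blocks tile the box. -/
theorem add_unitVec_mem_pbox_of_isCombBondAt (hN : 0 < N) {M : Fin (d + 1) → ℕ} (hM : ∀ i, N ∣ M i) {m : Fin (d + 1)} {p : Site (d + 1)}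
    (h : IsCombBondAt ρ N m p) (hp : p ∈ pbox M) : p + unitVec m ∈ pbox M := by
  rw [mem_pbox] at hp ⊢
  intro i
  have hq := ediv_add_unitVec_of_isCombBondAt h i
  have hb := block_bounds hN (p + unitVec m) i
  rw [hq] at hb
  have hN' : (0 : ℤ) < N := by exact_mod_cast hN
  have hx0 : 0 ≤ p i / (N : ℤ) := Int.ediv_nonneg (hp i).1 hN'.le
  obtain ⟨K, hK⟩ := hM i
  have hKM : (M i : ℤ) = (N : ℤ) * (K : ℤ) := by rw [hK]; push_cast; ring
  have hlt : p i / (N : ℤ) < (K : ℤ) := by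
    rw [Int.ediv_lt_iff_lt_mul hN']
    calc p i < (M i : ℤ) := (hp i).2
      _ = (K : ℤ) * (N : ℤ) := by rw [hKM, mul_comm]
  constructor
  · calc (0 : ℤ) ≤ (N : ℤ) * (p i / (N : ℤ)) := mul_nonneg hN'.le hx0
      _ ≤ (p + unitVec m) i := hb.1
  · calc (p + unitVec m) i < (N : ℤ) * (p i / (N : ℤ)) + N := hb.2
      _ = (N : ℤ) * (p i / (N : ℤ) + 1) := by ring
      _ ≤ (N : ℤ) * (K : ℤ) := mul_le_mul_of_nonneg_left (by omega) hN'.le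
      _ = (M i : ℤ) := hKM.symm

/-- [folklore] the lower coordinates of a comb bond's base sit at the root (the first clause of `IsCombBondAt`, in `rootOf` currency). -/
theorem eq_rootOf_of_isCombBondAt {m : Fin (d + 1)} {p : Site (d + 1)} (h : IsCombBondAt ρ N m p) {j : Fin (d + 1)} (hj : j < m) :
    p j = rootOf ρ N p j := by
  have := h.1 j hj
  simpa only [rootOf, Pi.add_apply, Pi.smul_apply, smul_eq_mul, blk] using this

end Forest

/-! ## §2 The comb field slots and the child of a comb bond -/

section Slots

variable (ρ : Site (d + 1)) (N : ℕ) (M : Fin (d + 1) → ℕ)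

/-- [our object — bookkeeping] **THE COMB FIELD SLOTS OF THE TORUS BOX**: the indices `(p, inl m)` of `Idx M (Fib d)` whose bond `[p, p + e_m]` is a comb bond of an2's chart
(`IsCombBondAt ρ N m p`) — an2's DEAD field coordinates (the field block of `axEc ρ N` vanishes exactly there). -/
def CombSlot : Type :=
  {q : Idx M (Fib d) // ∃ m : Fin (d + 1), q.2 = Sum.inl m ∧ IsCombBondAt ρ N m (q.1 : Site (d + 1))}

/-- [folklore] finitely many comb slots (a subtype of the finite index type). -/
noncomputable instance : Fintype (CombSlot ρ N M) := by unfold CombSlot; exact Fintype.ofFinite _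
/-- [folklore] decidable equality of comb slots. -/
instance : DecidableEq (CombSlot ρ N M) := by unfold CombSlot; infer_instance

variable {ρ N M}

/-- the axis of a comb slot. -/
theorem CombSlot.exists_axis (q : CombSlot ρ N M) : ∃ m : Fin (d + 1), q.1.2 = Sum.inl m ∧ IsCombBondAt ρ N m (q.1.1 : Site (d + 1)) := q.2

/-- [our object — bookkeeping] the axis of a comb slot (chosen). -/
def CombSlot.axis (q : CombSlot ρ N M) : Fin (d + 1) := Classical.choose q.exists_axis

/-- a comb slot is a field slot on its axis. -/
theorem CombSlot.snd_eq (q : CombSlot ρ N M) : q.1.2 = Sum.inl q.axis := (Classical.choose_spec q.exists_axis).1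

/-- the bond of a comb slot is a comb bond of an2's chart. -/
theorem CombSlot.isComb (q : CombSlot ρ N M) : IsCombBondAt ρ N q.axis (q.1.1 : Site (d + 1)) := (Classical.choose_spec q.exists_axis).2

/-- the base point of a comb slot, as a lattice site. -/
abbrev CombSlot.base (q : CombSlot ρ N M) : Site (d + 1) := (q.1.1 : Site (d + 1))

/-- [our object — bookkeeping] **THE CHILD SITE OF A COMB BOND** `[p, p + e_m]`: the endpoint FARTHER from the root — `p + e_m` if `root_m ≤ p_m`, else `p`. -/
def childSite (ρ : Site (d + 1)) (N : ℕ) (m : Fin (d + 1)) (p : Site (d + 1)) : Site (d + 1) :=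
  if rootOf ρ N p m ≤ p m then p + unitVec m else p

/-- above (or at) the root the child is the tip `p + e_m`. -/
theorem childSite_of_le {m : Fin (d + 1)} {p : Site (d + 1)} (h : rootOf ρ N p m ≤ p m) : childSite ρ N m p = p + unitVec m := if_pos h
/-- below the root the child is the base `p`. -/
theorem childSite_of_not_le {m : Fin (d + 1)} {p : Site (d + 1)} (h : ¬ rootOf ρ N p m ≤ p m) : childSite ρ N m p = p := if_neg h

/-- [folklore] the child has the root of the base. -/
theorem rootOf_childSite {m : Fin (d + 1)} {p : Site (d + 1)} (h : IsCombBondAt ρ N m p) : rootOf ρ N (childSite ρ N m p) = rootOf ρ N p := by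
  by_cases hle : rootOf ρ N p m ≤ p m
  · rw [childSite_of_le hle]; exact rootOf_add_unitVec_of_isCombBondAt h
  · rw [childSite_of_not_le hle]

/-- [folklore] **THE CHILD DEVIATES ON THE AXIS** — it is never a root. -/
theorem childSite_axis_ne {m : Fin (d + 1)} {p : Site (d + 1)} (h : IsCombBondAt ρ N m p) :
    childSite ρ N m p m ≠ rootOf ρ N (childSite ρ N m p) m := by
  rw [rootOf_childSite h]
  by_cases hle : rootOf ρ N p m ≤ p m
  · rw [childSite_of_le hle, add_unitVec_apply, if_pos rfl]; omega
  · rw [childSite_of_not_le hle]; omega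

/-- [folklore] the child of a comb bond is not a root. -/
theorem childSite_ne_rootOf {m : Fin (d + 1)} {p : Site (d + 1)} (h : IsCombBondAt ρ N m p) : childSite ρ N m p ≠ rootOf ρ N (childSite ρ N m p) :=
  fun e => childSite_axis_ne h (congrFun e m)

/-- [folklore] the child lies in the box. -/
theorem childSite_mem_pbox (hN : 0 < N) (hM : ∀ i, N ∣ M i) {m : Fin (d + 1)} {p : Site (d + 1)} (h : IsCombBondAt ρ N m p) (hp : p ∈ pbox M) :
    childSite ρ N m p ∈ pbox M := by
  by_cases hle : rootOf ρ N p m ≤ p m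
  · rw [childSite_of_le hle]; exact add_unitVec_mem_pbox_of_isCombBondAt hN hM h hp
  · rw [childSite_of_not_le hle]; exact hp

/-- [folklore] **THE AXIS OF THE CHILD IS THE BOND's AXIS.** -/
theorem axisOf_childSite {m : Fin (d + 1)} {p : Site (d + 1)} (h : IsCombBondAt ρ N m p) : axisOf ρ N (childSite ρ N m p) = m := by
  refine axisOf_eq_of (childSite_axis_ne h) (fun j hj => ?_)
  rw [rootOf_childSite h]
  have hpj := eq_rootOf_of_isCombBondAt h hj
  by_cases hle : rootOf ρ N p m ≤ p m
  · rw [childSite_of_le hle, add_unitVec_apply, if_neg (ne_of_lt hj)]; exact hpj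
  · rw [childSite_of_not_le hle]; exact hpj

/-- [folklore] **THE BASE OF THE CHILD IS THE BOND's BASE.** -/
theorem baseOf_childSite {m : Fin (d + 1)} {p : Site (d + 1)} (h : IsCombBondAt ρ N m p) : baseOf ρ N (childSite ρ N m p) = p := by
  have hax := axisOf_childSite (ρ := ρ) (N := N) h
  by_cases hle : rootOf ρ N p m ≤ p m
  · -- above the root: base = step = child − e_m = p
    have hc := childSite_of_le (ρ := ρ) (N := N) hle
    have hlt : rootOf ρ N (childSite ρ N m p) (axisOf ρ N (childSite ρ N m p)) < childSite ρ N m p (axisOf ρ N (childSite ρ N m p)) := by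
      rw [hax, rootOf_childSite h, hc, add_unitVec_apply, if_pos rfl]; omega
    rw [(base_tip_of_lt hlt).1]
    have hsign : signOf ρ N (childSite ρ N m p) = 1 := by
      unfold signOf; rw [if_pos hlt]
    funext j
    rw [stepOf_apply, hax, hsign, hc]
    by_cases hj : j = m
    · subst hj; rw [if_pos rfl, add_unitVec_apply, if_pos rfl]; ring
    · rw [if_neg hj, add_unitVec_apply, if_neg hj]
  · have hc := childSite_of_not_le (ρ := ρ) (N := N) hle
    have hnlt : ¬ rootOf ρ N (childSite ρ N m p) (axisOf ρ N (childSite ρ N m p)) < childSite ρ N m p (axisOf ρ N (childSite ρ N m p)) := by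
      rw [hax, rootOf_childSite h, hc]; omega
    rw [(base_tip_of_not_lt hnlt).1, hc]

variable (ρ N M)

/-- [our object — bookkeeping] **THE CHILD OF A COMB SLOT AS A RESIDUAL PARAMETER** (needs `0 < N`, `N ∣ M_i` for box membership). -/
def childOf (hN : 0 < N) (hM : ∀ i, N ∣ M i) (q : CombSlot ρ N M) : Res ρ N M :=
  ⟨⟨childSite ρ N q.axis q.base, childSite_mem_pbox hN hM q.isComb q.1.1.2⟩, childSite_ne_rootOf q.isComb⟩

/-- [our object — bookkeeping] **THE COMB SLOT OF A RESIDUAL PARAMETER**: `combBondT x` with its comb certificate. -/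
def combSlotOf (hN : 0 < N) (hρ : ∀ i, 0 ≤ ρ i ∧ ρ i < N) (hM : ∀ i, N ∣ M i) (x : Res ρ N M) : CombSlot ρ N M :=
  ⟨combBondT ρ N M x, ⟨axisOf ρ N x.site, by rw [combBondT_eq hN hρ hM x], by
    rw [combBondT_eq hN hρ hM x]; exact isCombBondAt_baseOf hN hρ x.not_root⟩⟩

variable {ρ N M}

/-- the underlying index of `combSlotOf x` is `combBondT x`. -/
theorem combSlotOf_val (hN : 0 < N) (hρ : ∀ i, 0 ≤ ρ i ∧ ρ i < N) (hM : ∀ i, N ∣ M i) (x : Res ρ N M) :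
    (combSlotOf ρ N M hN hρ hM x).1 = combBondT ρ N M x := rfl

/-- the site of `childOf q` is the child site of the bond of `q`. -/
theorem childOf_site (hN : 0 < N) (hM : ∀ i, N ∣ M i) (q : CombSlot ρ N M) : (childOf ρ N M hN hM q).site = childSite ρ N q.axis q.base := rfl

end Slots

/-! ## §3 The bijection and its corollaries -/

section Equiv

variable {ρ : Site (d + 1)} {N : ℕ} {M : Fin (d + 1) → ℕ}

/-- [folklore] the axis and base of `combSlotOf x` are those of `x`. -/
theorem axis_combSlotOf (hN : 0 < N) (hρ : ∀ i, 0 ≤ ρ i ∧ ρ i < N) (hM : ∀ i, N ∣ M i) (x : Res ρ N M) :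
    (combSlotOf ρ N M hN hρ hM x).axis = axisOf ρ N x.site := by
  have h := (combSlotOf ρ N M hN hρ hM x).snd_eq
  rw [combSlotOf_val, combBondT_eq hN hρ hM x] at h
  exact (Sum.inl_injective h).symm

/-- [folklore] the base of `combSlotOf x` is `baseOf x`. -/
theorem base_combSlotOf (hN : 0 < N) (hρ : ∀ i, 0 ≤ ρ i ∧ ρ i < N) (hM : ∀ i, N ∣ M i) (x : Res ρ N M) :
    (combSlotOf ρ N M hN hρ hM x).base = baseOf ρ N x.site := by
  show (((combSlotOf ρ N M hN hρ hM x).1).1 : Site (d + 1)) = _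
  rw [combSlotOf_val, combBondT_eq hN hρ hM x]

/-- [folklore] **CHILD ∘ SLOT = id**: the child of the comb bond into `x` is `x`. -/
theorem childOf_combSlotOf (hN : 0 < N) (hρ : ∀ i, 0 ≤ ρ i ∧ ρ i < N) (hM : ∀ i, N ∣ M i) (x : Res ρ N M) :
    childOf ρ N M hN hM (combSlotOf ρ N M hN hρ hM x) = x := by
  rw [Res.ext_iff', childOf_site, axis_combSlotOf, base_combSlotOf]
  by_cases hlt : rootOf ρ N x.site (axisOf ρ N x.site) < x.site (axisOf ρ N x.site)
  · -- above: base = step x, child = step x + e_m = x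
    rw [(base_tip_of_lt hlt).1]
    have hle : rootOf ρ N (stepOf ρ N x.site) (axisOf ρ N x.site) ≤ stepOf ρ N x.site (axisOf ρ N x.site) := by
      rw [rootOf_stepOf hN hρ x.not_root, stepOf_apply, if_pos rfl]
      unfold signOf; rw [if_pos hlt]; omega
    rw [childSite_of_le hle]
    have h2 := (base_tip_of_lt hlt).2
    unfold tipOf at h2
    rw [(base_tip_of_lt hlt).1] at h2
    exact h2
  · rw [(base_tip_of_not_lt hlt).1]
    have hdev := axisOf_dev x.not_root
    have hnle : ¬ rootOf ρ N x.site (axisOf ρ N x.site) ≤ x.site (axisOf ρ N x.site) := fun h => hlt (lt_of_le_of_ne h (Ne.symm hdev))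
    rw [childSite_of_not_le hnle]

/-- [folklore] **SLOT ∘ CHILD = id**: the comb bond into the child of a comb bond is that bond. -/
theorem combSlotOf_childOf (hN : 0 < N) (hρ : ∀ i, 0 ≤ ρ i ∧ ρ i < N) (hM : ∀ i, N ∣ M i) (q : CombSlot ρ N M) :
    combSlotOf ρ N M hN hρ hM (childOf ρ N M hN hM q) = q := by
  apply Subtype.ext
  rw [combSlotOf_val, combBondT_eq hN hρ hM]
  have hsite : (childOf ρ N M hN hM q).site = childSite ρ N q.axis q.base := rfl
  apply Prod.ext
  · apply Subtype.ext
    show baseOf ρ N (childOf ρ N M hN hM q).site = q.base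
    rw [hsite, baseOf_childSite q.isComb]
  · show Sum.inl (axisOf ρ N (childOf ρ N M hN hM q).site) = q.1.2
    rw [hsite, axisOf_childSite q.isComb, q.snd_eq]

/-- [our object — bookkeeping] **THE RESIDUAL PARAMETERS ARE IN BIJECTION WITH THE COMB FIELD SLOTS** (`t ≃ Res` for the `kkt`∕`kBig` dress). -/
def resEquivCombSlot (hN : 0 < N) (hρ : ∀ i, 0 ≤ ρ i ∧ ρ i < N) (hM : ∀ i, N ∣ M i) : Res ρ N M ≃ CombSlot ρ N M where
  toFun := combSlotOf ρ N M hN hρ hM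
  invFun := childOf ρ N M hN hM
  left_inv := childOf_combSlotOf hN hρ hM
  right_inv := combSlotOf_childOf hN hρ hM

/-- [folklore] **`combBondT` IS INJECTIVE** (distinct residual parameters have distinct comb bonds into them). -/
theorem combBondT_injective (hN : 0 < N) (hρ : ∀ i, 0 ≤ ρ i ∧ ρ i < N) (hM : ∀ i, N ∣ M i) : Function.Injective (combBondT ρ N M) := by
  intro x y h
  have h' : combSlotOf ρ N M hN hρ hM x = combSlotOf ρ N M hN hρ hM y := Subtype.ext h
  exact (resEquivCombSlot hN hρ hM).injective h'

/-- [folklore] as many residual parameters as comb field slots (the comb slice is square). -/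
theorem card_res_eq_card_combSlot (hN : 0 < N) (hρ : ∀ i, 0 ≤ ρ i ∧ ρ i < N) (hM : ∀ i, N ∣ M i) :
    Fintype.card (Res ρ N M) = Fintype.card (CombSlot ρ N M) :=
  Fintype.card_congr (resEquivCombSlot hN hρ hM)

/-- [folklore] **THE SLICE ROWS VANISH OFF THE COMB FIELD SLOTS** (i.e. on an2's LIVE coordinates: non-comb field slots and all multiplier slots). -/
theorem combRowsT_apply_eq_zero_of_not_comb (hN : 0 < N) (hρ : ∀ i, 0 ≤ ρ i ∧ ρ i < N) (hM : ∀ i, N ∣ M i) (x : Res ρ N M) (q : Idx M (Fib d))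
    (hq : ¬ ∃ m : Fin (d + 1), q.2 = Sum.inl m ∧ IsCombBondAt ρ N m (q.1 : Site (d + 1))) : combRowsT ρ N M x q = 0 := by
  unfold combRowsT
  rw [if_neg]
  intro h
  apply hq
  rw [h]
  exact (combSlotOf ρ N M hN hρ hM x).2

end Equiv

end Summit.QuantumFields.BalabanUV.Beta.FP.TorusCombSlots

end
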